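import Summits.Ventures.Crystal3D.Theorems.StickyWulffConstantCoaxialWallLawHalfPlanarCertA
import Summits.Ventures.Crystal3D.Theorems.StickyWulffConstantCoaxialWallLawHalfPlanarCertB
import Summits.Ventures.Crystal3D.Theorems.StickyWulffConstantCoaxialWallLawHalfPlanarCertC
import Summits.Ventures.Crystal3D.Theorems.StickyWulffConstantCoaxialWallLawHalfPlanarCertD
import Summits.Ventures.Crystal3D.Theorems.StickyWulffConstantCoaxialWallLawHalfPlanarCertE
import Summits.Ventures.Crystal3D.Theorems.StickyWulffConstantCoaxialWallLawHalfPlanarCertF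
import Summits.Ventures.Crystal3D.Theorems.StickyWulffConstantCoaxialWallLawHalfPlanarCertG
import HarnessLib

/-!
# The planar-heights certificate at offset `½`, KERNEL GRADE (assembly of the 25 `decide +kernel` sub-certificates)

HONEST FRAMING. Part of the venture `Summits/Ventures/Crystal3D` (cell `crystal3d-full`), helper
`--supports` the crux `CoaxialWallLaw` (stmt-Ventures-19481, `route-Ventures-StickyWulffConstant`),
REGISTERED line `WallLedgerF`, open stub `stub_coaxialTwoSlabAdhesion`.  RUNG CREDIT ONLY; F-C1 not moved.

* `azSearchFGo_succ_of_children` — two-level expansion of the forward-pruning search `azSearchFGo`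
  (`…AzimuthSchedulingFwd`): a node is certified as soon as every child is.
* **`hp_cert_kernel : azSearchF hpTbl 62832 [5,12,12,12,12] 0 12 = true` on STANDARD AXIOMS** — expanded twice and
  closed by the 25 depth-2 sub-certificates `hp_kcert_a₁a₂` (`…HalfPlanarCertA … G`, each `decide +kernel` within the
  default heartbeats).  `…CoaxialWallLawBiPlanarRowHalf` re-proves its `hp_cert` by this theorem, which upgrades
  `halfPlanar_card_le_eleven` / `coaxialTwoSlabAdhesion_biPlanar_half` from computational (`native_decide`) to kernel grade.
-/

namespace Summit.Ventures.Crystal3D.Theorems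

/-- Two-level expansion of the forward-pruning search: a node is certified as soon as every child is. -/
theorem azSearchFGo_succ_of_children {tbl : List (List ℤ)} {T : ℤ} {cap : List ℕ} {fuel : ℕ}
    {pre : List ℕ} {pos : List ℤ}
    (h : ∀ a, a < tbl.length →
      azSearchFGo tbl T cap fuel (pre ++ [a]) (pos ++ [azFwdAux tbl pre pos a pre.length]) = true) :
    azSearchFGo tbl T cap (fuel + 1) pre pos = true := by
  unfold azSearchFGo
  rw [List.all_eq_true]
  intro a ha
  rw [List.mem_range] at ha
  simp only [Bool.or_eq_true]
  exact Or.inr (Or.inr (h a ha))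

/-- **The certificate at offset `½`, KERNEL GRADE** (assembled from the 25 depth-2 sub-certificates). -/
theorem hp_cert_kernel : azSearchF hpTbl 62832 [5, 12, 12, 12, 12] 0 12 = true := by
  unfold azSearchF
  rw [show (12 - 1 : ℕ) = 10 + 1 from rfl]
  apply azSearchFGo_succ_of_children
  intro a1 h1
  have h1' : a1 < 5 := by simpa [hpTbl] using h1
  rw [show (10 : ℕ) = 9 + 1 from rfl]
  apply azSearchFGo_succ_of_children
  intro a2 h2
  have h2' : a2 < 5 := by simpa [hpTbl] using h2
  interval_cases a1 <;> interval_cases a2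
  · norm_num [azFwdAux, azGet, hpTbl]
    exact hp_kcert_00
  · norm_num [azFwdAux, azGet, hpTbl]
    exact hp_kcert_01
  · norm_num [azFwdAux, azGet, hpTbl]
    exact hp_kcert_02
  · norm_num [azFwdAux, azGet, hpTbl]
    exact hp_kcert_03
  · norm_num [azFwdAux, azGet, hpTbl]
    exact hp_kcert_04
  · norm_num [azFwdAux, azGet, hpTbl]
    exact hp_kcert_10
  · norm_num [azFwdAux, azGet, hpTbl]
    exact hp_kcert_11
  · norm_num [azFwdAux, azGet, hpTbl]
    exact hp_kcert_12
  · norm_num [azFwdAux, azGet, hpTbl]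
    exact hp_kcert_13
  · norm_num [azFwdAux, azGet, hpTbl]
    exact hp_kcert_14
  · norm_num [azFwdAux, azGet, hpTbl]
    exact hp_kcert_20
  · norm_num [azFwdAux, azGet, hpTbl]
    exact hp_kcert_21
  · norm_num [azFwdAux, azGet, hpTbl]
    exact hp_kcert_22
  · norm_num [azFwdAux, azGet, hpTbl]
    exact hp_kcert_23
  · norm_num [azFwdAux, azGet, hpTbl]
    exact hp_kcert_24
  · norm_num [azFwdAux, azGet, hpTbl]
    exact hp_kcert_30
  · norm_num [azFwdAux, azGet, hpTbl]
    exact hp_kcert_31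
  · norm_num [azFwdAux, azGet, hpTbl]
    exact hp_kcert_32
  · norm_num [azFwdAux, azGet, hpTbl]
    exact hp_kcert_33
  · norm_num [azFwdAux, azGet, hpTbl]
    exact hp_kcert_34
  · norm_num [azFwdAux, azGet, hpTbl]
    exact hp_kcert_40
  · norm_num [azFwdAux, azGet, hpTbl]
    exact hp_kcert_41
  · norm_num [azFwdAux, azGet, hpTbl]
    exact hp_kcert_42
  · norm_num [azFwdAux, azGet, hpTbl]
    exact hp_kcert_43
  · norm_num [azFwdAux, azGet, hpTbl]
    exact hp_kcert_44

end Summit.Ventures.Crystal3D.Theorems
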